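import Summits.MatrixMultiplication.OmegaCensus.STPPSmallPatternWitnesses

/-!
# ω-census, small pattern `(2,1,1)¹¹`: non-cyclic order-81 type(s) HOST — kernel witness(es) (conjecture C10 (c″) cyclic-last at `k = 11`, order `81`)

Cell `pub-omega`, ω construction census, seat pub-omega ENG2 (gen 39; file generator of gen 37). HONEST FRAMING (verbatim): lottery ticket; floor =
certified bounds/negative ranges.  Census STRUCTURE bookkeeping (row B5, column `T1` at `k = 11`; conjecture C10 (c″): «for `n ≥ r_k` every abelian group of
order `n` hosts `(2,1,1)^k`»); nothing here bears on `ω`.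

The `T1` order law at `k = 11` stands at `82` (`exists_isSTPP_211pow11_of_card_ge_82`) while the cyclic ray starts at `81`
(`exists_isSTPP_211pow11_zmod_of_le81`); a law at `81` needs the four non-cyclic abelian types of order `81` (`[27,3]`, `[9,9]`, `[9,3,3]`, `[3,3,3,3]`),
which resisted engine γ at the desk (≈ 1 000 capped `C` each, ENG2 gen 36) and in kit GO #167 (cap `4·10⁷`).  SOURCE: night-34 reserve R2f = kit
GO #176 j337414 'eng2-capwalk3-arm3' (engine γ capped random-`C` walk, cap `1.6·10⁸`, 3 seeds × 1 800 s per cell, 2026-08-30) found `(2,1,1)¹¹ ⊆ ℤ/9 × ℤ/9`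
(seed 5136); `[27,3]`, `[9,3,3]`, `[3,3,3,3]` blank at that budget (no claim; `[3,3,3,3]` is the object of card F81-COMPLETE).  Record: the night lead's
byte copy HOME `U/lead-g44/results/kit-j337414/outputs/found.txt` (sha16 38141503cc61513b).  Each family is re-checked against Def. 5.1 (in the job, by
ENG2 gen 39's from-scratch `def51_found_g39.py` with 30 planted mutants, and after parsing by harvest.py) and certified here by `decide` on the tree's `stppCheck` (`exists_isSTPP_of_lists_cards`; `A_i` = the pair, `B_i = {c_i}`, `C_i = {0}`).
No law is re-filed in this file; further order-81 witnesses are APPENDED here as they fall.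
References: H. Cohn, R. Kleinberg, B. Szegedy, C. Umans, FOCS 2005 (arXiv:math/0511460), Def. 5.1.  Seat pub-omega ENG2 (gen 39), 2026-08-30.
-/

open Literature.Computability.AlgebraicComplexity Finset

namespace Summit.MatrixMultiplication.OmegaCensus

/-- **`(2,1,1)¹¹ ⊆ ℤ/9 × ℤ/9`** (order `81`); engine γ capped random-`C` find, kit GO #176 j337414 'eng2-capwalk3-arm3' (night 34, 2026-08-30), cap `1.6·10⁸`, seed 5136; family re-checked against Def. 5.1 in the engine (def51.py, 20/20 planted mutants in-job) and on the hub by ENG2 gen 39's from-scratch `def51_found_g39.py` (5324 words, 0 violations, pattern cards `(2,1,1)`, 30/30 single-element mutants rejected); parsed and re-checked by harvest.py (literal Def. 5.1: PASS). [cite: CohnKleinbergSzegedyUmans2005, Def. 5.1] -/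
theorem exists_isSTPP_211pow11_seed_9_9 :
    ∃ A B C : Fin 11 → Finset (ZMod 9 × ZMod 9), IsSTPP A B C ∧ ∀ i, (A i).card = 2 ∧ (B i).card = 1 ∧ (C i).card = 1 :=
  exists_isSTPP_of_lists_cards (H := ZMod 9 × ZMod 9)
    ![[(0, 0), (0, 1)], [(4, 2), (7, 8)], [(7, 5), (0, 3)], [(3, 2), (5, 0)], [(3, 1), (5, 7)], [(4, 1), (7, 1)], [(0, 4), (3, 7)], [(8, 2), (0, 8)], [(1, 0), (1, 1)], [(3, 3), (7, 6)], [(6, 6), (7, 3)]]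
    ![[(0, 0)], [(2, 7)], [(2, 8)], [(3, 4)], [(3, 8)], [(4, 5)], [(6, 0)], [(6, 2)], [(8, 3)], [(8, 7)], [(8, 8)]]
    ![[(0, 0)], [(0, 0)], [(0, 0)], [(0, 0)], [(0, 0)], [(0, 0)], [(0, 0)], [(0, 0)], [(0, 0)], [(0, 0)], [(0, 0)]]
    (by decide +kernel) (by decide +kernel)

end Summit.MatrixMultiplication.OmegaCensus
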